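import Summits.AtomisticToContinuum.Crystallization.Theorems.ShellsToBarlowChart.Negative.Calibration

/-!
# Line `develop-the-model-growth-descent` (crux `ShellsToBarlowChart`, stmt-AtomisticToContinuum-9227): the transport system

Definition (D-0016: reviewed) used to split the hardest stub `stub_modelCovering` of the line
into a GEOMETRIC half (`stub_transportSystem`: an every-point-good set with local charts carries
a transport system — three commuting permutations `I, J, V` of an abstract frame type realising
the three generating contacts `(k,i,j) ↦ (k,i+1,j), (k,i,j+1), (k+1,i,j)` of a Barlow stacking,
with a parity `par = ±1` read at each frame that plays the Hägg letter) and an ALGEBRAIC half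
(`stub_developCovering`: a transport system yields a Hägg word `s k := par (V^k f₀)` and a bond
covering `Ψ (barlowPos 1 √(2/3) s k i j) := pt (V^k (J^j (I^i f₀)))`).  The star and link
clauses are written in the relative coordinates `linkOffsets` / `linkAdj` of
`Literature/MathematicalPhysics/StatisticalMechanics/BarlowRings.lean`, so that the algebraic
half is `touching_iff_exists_linkOffsets` + `dist_relPos_eq_iff_linkAdj` + bookkeeping.

* `TransportSystem S` — the predicate.  `[folklore]` (discrete `(G,X)`-structure / developing
  map for the contact graph of close packings; cf. HalesDSP2012 §1.3 for the layer induction it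
  abstracts).
* `fcc3Int`, `IsZChart`, `hexLabels`, `IsFrame`, `frameParity` — the integer-label vocabulary of
  the geometric half (both kissing patterns in `ℤ³` at squared norm `18`; charts = `LocalChart`
  over `ℤ³`; frames = ordered touching pair spanning a hexagon + an upper cap; parity = the Hägg
  letter read in one chart).
-/

noncomputable section

namespace Summit.AtomisticToContinuum.Crystallization.Theorems.PalmUnimodularRigidityShellsToBarlowChart

open Literature.Geometry.DiscreteGeometry Literature.MathematicalPhysics.StatisticalMechanics
open Summit.AtomisticToContinuum.Crystallization.Theorems.ShellsToBarlowChartNegative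

/-- Euclidean `3`-space. -/
local notation "E3" => EuclideanSpace ℝ (Fin 3)

/-- **Transport system on `S`.**  An abstract type of frames `F` with a point map `pt : F → S`,
three pairwise COMMUTING permutations `I, J, V` of `F` (transport along the two in-layer
generators and to the next layer), a parity `par : F → {1, −1}` invariant under `I` and `J`
(the Hägg letter of the layer of the frame), and a base frame `f₀`, such that (i) every point of
`S` is reached from `f₀` (`pt (V^c (J^b (I^a f₀))) = y`), (ii) STAR: at every frame `f` the
twelve frames `V^r (J^(−Q) (I^(−P) f))`, `(r,P,Q) ∈ linkOffsets (par (V⁻¹ f)) (par f)` (the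
relative coordinates of the twelve contacts of a site of a Barlow stacking whose layer letters
below/above are `par (V⁻¹ f)`, `par f`), are mapped by `pt` bijectively onto the bonded
neighbours of `pt f` (bond = distance in `(0, 28/25]`), and (iii) LINK: two of these twelve
points are bonded iff the corresponding relative coordinates are `linkAdj`. [folklore] -/
def TransportSystem (S : Set E3) : Prop :=
  ∃ (F : Type) (pt : F → E3) (I J V : Equiv.Perm F) (par : F → ℤ) (f₀ : F),
    (∀ f, I (J f) = J (I f)) ∧ (∀ f, I (V f) = V (I f)) ∧ (∀ f, J (V f) = V (J f)) ∧
    (∀ f, pt f ∈ S) ∧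
    (∀ f, par f = 1 ∨ par f = -1) ∧ (∀ f, par (I f) = par f) ∧ (∀ f, par (J f) = par f) ∧
    (∀ y ∈ S, ∃ a b c : ℤ, pt ((V ^ c) ((J ^ b) ((I ^ a) f₀))) = y) ∧
    (∀ f, Set.BijOn (fun x : ℤ × ℤ × ℤ => pt ((V ^ x.1) ((J ^ (-x.2.2)) ((I ^ (-x.2.1)) f))))
        (↑(linkOffsets (par (V⁻¹ f)) (par f)) : Set (ℤ × ℤ × ℤ))
        {y | y ∈ S ∧ (0 < dist (pt f) y ∧ dist (pt f) y ≤ 28 / 25)}) ∧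
    (∀ f, ∀ x ∈ linkOffsets (par (V⁻¹ f)) (par f), ∀ y ∈ linkOffsets (par (V⁻¹ f)) (par f),
        ((0 < dist (pt ((V ^ x.1) ((J ^ (-x.2.2)) ((I ^ (-x.2.1)) f))))
                (pt ((V ^ y.1) ((J ^ (-y.2.2)) ((I ^ (-y.2.1)) f)))) ∧
          dist (pt ((V ^ x.1) ((J ^ (-x.2.2)) ((I ^ (-x.2.1)) f))))
                (pt ((V ^ y.1) ((J ^ (-y.2.2)) ((I ^ (-y.2.1)) f)))) ≤ 28 / 25) ↔
          linkAdj (par (V⁻¹ f)) (par f) x y))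

/-! ## Integer charts and frames (vocabulary of the geometric half `stub_transportSystem`) -/

/-- The FCC kissing pattern at squared norm `18` (`3 · fccInt`, listed in the order of `fccInt`:
all permutations of `(±3, ±3, 0)`), so that BOTH patterns live in `ℤ³` with touching pairs at
squared distance `18` (`fcc3Int = fccInt.image (3 • ·)` and `fccKissingPattern =
scaledPattern fcc3Int 18` are proved in the sibling files). [cite: ConwaySloane1999, Ch. 4 §6.3] -/
def fcc3Int : Finset (Fin 3 → ℤ) :=
  {![3, 3, 0], ![3, -3, 0], ![-3, 3, 0], ![-3, -3, 0],
   ![3, 0, 3], ![3, 0, -3], ![-3, 0, 3], ![-3, 0, -3],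
   ![0, 3, 3], ![0, 3, -3], ![0, -3, 3], ![0, -3, -3]}

/-- **Integer chart at `x ∈ S`**: a scale `a ∈ [9/10, 1]`, an integer pattern `P` (`fcc3Int` or
`hcpInt`), a linear isometry `A` and the labelling `nbr : ℤ³ → ℝ³` mapping `P` bijectively onto
the bonded neighbours of `x` (bond = distance in `(0, 28/25]`), each label `t` landing within
`a/100` of its ideal position `x + (a/√18)·A t`, with bonds among neighbours = label pairs at
squared distance `18` (the content of `LocalChart`, rewritten over `ℤ³`). [folklore] -/
def IsZChart (S : Set E3) (x : E3) (a : ℝ) (P : Finset (Fin 3 → ℤ)) (A : E3 →ₗᵢ[ℝ] E3)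
    (nbr : (Fin 3 → ℤ) → E3) : Prop :=
  (P = fcc3Int ∨ P = hcpInt) ∧ 9 / 10 ≤ a ∧ a ≤ 1 ∧
    Set.BijOn nbr (↑P : Set (Fin 3 → ℤ)) {y | y ∈ S ∧ (0 < dist x y ∧ dist x y ≤ 28 / 25)} ∧
    (∀ t ∈ P, dist (nbr t) (x + (a * (Real.sqrt 18)⁻¹) • A (intVec t)) ≤ a / 100) ∧
    (∀ t ∈ P, ∀ t' ∈ P,
      ((0 < dist (nbr t) (nbr t') ∧ dist (nbr t) (nbr t') ≤ 28 / 25) ↔ sqNormInt (t - t') = 18))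

/-- The six hexagon labels spanned by an ordered adjacent pair `(t₁, t₂)` of labels at `60°`:
`t₁, t₂, t₂ − t₁, −t₁, −t₂, t₁ − t₂` (consecutive vertices of the planar hexagon through the
centre). [folklore] -/
def hexLabels (t₁ t₂ : Fin 3 → ℤ) : Finset (Fin 3 → ℤ) := {t₁, t₂, t₂ - t₁, -t₁, -t₂, t₁ - t₂}

/-- **Frame in the pattern `P`**: an ordered touching pair `(t₁, t₂)` whose hexagon lies in `P`
(the in-layer directions: `t₁` = first generator, `t₂` = second generator at `60°`), and a CAP
`U ⊆ P` off the hexagon — the declared UPPER side (orientation is carried combinatorially, never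
by a cross product, since charts may be improper) — which is either the EVEN cap
`{c, c − t₁, c − t₂}` (a label `c` over the triangle `(0, t₁, t₂)` and its two translates) or the
ODD cap `{c, c + t₁, c + t₂}` (`c` over `(0, −t₁, −t₂)`); in both kissing patterns every cap has
exactly one of these forms. [folklore] -/
def IsFrame (P : Finset (Fin 3 → ℤ)) (t₁ t₂ : Fin 3 → ℤ) (U : Finset (Fin 3 → ℤ)) : Prop :=
  sqNormInt (t₁ - t₂) = 18 ∧ hexLabels t₁ t₂ ⊆ P ∧ U ⊆ P ∧ (∀ u ∈ U, u ∉ hexLabels t₁ t₂) ∧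
    ∃ c ∈ U, (U = {c, c - t₁, c - t₂} ∨ U = {c, c + t₁, c + t₂})

/-- **Parity of a frame**: `+1` if the upper cap has a label touching both `t₁` and `t₂` (the
even cap, over the triangle `(0, t₁, t₂)`), else `−1` (the odd cap, over `(0, −t₁, −t₂)`).  In
the development this is the Hägg letter `s k` of the layer of the frame: the next layer sits over
the even holes iff `s k = 1` (`BarlowCoordination.threeOffsets`). [folklore] -/
def frameParity (t₁ t₂ : Fin 3 → ℤ) (U : Finset (Fin 3 → ℤ)) : ℤ :=
  if ∃ c ∈ U, sqNormInt (c - t₁) = 18 ∧ sqNormInt (c - t₂) = 18 then 1 else -1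

/-- Anchor (registered sub-goal of stmt-AtomisticToContinuum-9227): a transport system has a
frame, hence `S` is non-empty. [folklore] -/
theorem transportSystem_nonempty : ∀ S : Set (EuclideanSpace ℝ (Fin 3)), TransportSystem S → S.Nonempty := by
  intro S h
  obtain ⟨F, pt, I, J, V, par, f₀, -, -, -, hS, -⟩ := h
  exact ⟨pt f₀, hS f₀⟩

end Summit.AtomisticToContinuum.Crystallization.Theorems.PalmUnimodularRigidityShellsToBarlowChart

end
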